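import Literature.NumberTheory.ModularForms.SiegelUnfolding
import Literature.NumberTheory.ModularForms.Sp4ZPrimitiveVectors
import Literature.NumberTheory.Automorphic.HyperbolicLaplaceSpectrum
import HarnessLib

/-!
# The stabiliser `Γ∞` of a primitive vector in `Sp₄(ℤ)`, its exact fundamental domain, and the cusp integral

Stage 5b of the bottom-up proof of Siegel's volume formula
`Literature.NumberTheory.ModularForms.Siegel1943_vol_F2` (`vol(F₂) = π³/270`; [cite: Klingen1990,
Ch. I §3, closing remark]), on top of `SiegelUnfolding.lean` (the action of `Sp₄(ℤ)` on
`↥U = H₂ ⊂ ℝ⁶`, `siegelVolume`, `IsSiegelFD`). In the unfolding of `∫_{F} (θ_Z(s) - 1) dv` the sum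
over primitive vectors becomes a sum over `Sp₄(ℤ)/Γ∞`, `Γ∞ = Stab(e)`, `e = (0,1;0,0)`, and one needs
an exact fundamental domain `𝓓∞` of `Γ∞` together with the value of `∫_{𝓓∞} F(t) dv`. Everything is
PROVED (no named facts):

* `GammaInf`, `GammaInf.structure`, `GammaInf.decomp` — `Γ∞` is the Jacobi group
  `{heis λ μ κ · embSL g}` (`g ∈ SL₂(ℤ)` embedded on the coordinates `(x₀, x₃)`, Klingen I.3 Prop. 6,
  and Heisenberg elements), read off from the symplectic relations.
* `smulVec_heis`, `smulZ_embSL`, `rho_embSL_smul` — the generators in coordinates: `heis λ μ κ`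
  translates `(u₂, u₁, t₁)`, `embSL g` acts on `ρ = x₀ + i x₃ ∈ ℍ` by Möbius transformations
  (Mathlib's `SL(2,ℤ)`-action on `ℍ`).
* `DInf`, `DInf_covers`, `DInf_unique`, `isSiegelFD_DInf` — the domain
  `𝓓∞ = {ρ ∈ 𝒟, u₂ ∈ [0,1/2], u₁ ∈ [0,1), t₁ ∈ [0,1)}` (`u₂ = x₄/x₃`, `u₁ = x₀x₄/x₃ - x₁`; Pioline,
  arXiv:1602.00308, (3.5)–(3.6)) is an exact fundamental domain for `Γ∞` (uniqueness off the null set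
  `ρ ∈ ∂𝒟 ∪ {u₂ ∈ {0, 1/2}}`, using `ModularGroup.eq_one_or_neg_one_of_mem_fdo_mem_fd`).
* `Phi`, `det_jacPhi`, `hasFDerivAt_Phi`, `setLIntegral_DInf` — the cusp coordinates
  `(ρ₁, ρ₂, u₂, u₁, t₁, t) ↦ x` (Jacobian `ρ₂`, `det Y = ρ₂ t`) and **the cusp integral**
  `∫_{𝓓∞} F(t(p)) dv(p) = (π/3) · (1/2) · ∫_0^∞ F(t) t⁻³ dt`, from the change of variables, a product
  decomposition of Lebesgue measure on `ℝ⁶` (`setLIntegral_pi_split`) and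
  `Literature.NumberTheory.Automorphic.volume_modular_fd` (`vol(𝒟) = π/3`).

## References

* H. Klingen, *Introductory Lectures on Siegel Modular Forms*, CUP 1990, Ch. I §3. [Klingen1990]
* B. Pioline, *Rankin-Selberg methods for closed string amplitudes*, arXiv:1602.00308, App. (3.5)–(3.7).
-/

noncomputable section

namespace Literature.NumberTheory.ModularForms.Sp4Covolume

open Complex Matrix

/-! ### The stabiliser `Γ∞` of the primitive vector `e` and its structure -/

section Stab

open MeasureTheory Set

/-- `Γ∞ = Stab(e) ≤ Sp₄(ℤ)`. [folklore] -/
def GammaInf : Subgroup Sp4Z := MulAction.stabilizer Sp4Z e0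

/-- The integer matrix of `γ ∈ Sp₄(ℤ)` (a typed abbreviation). [folklore] -/
abbrev mOf (γ : Sp4Z) : Matrix (Fin 2 ⊕ Fin 2) (Fin 2 ⊕ Fin 2) ℤ := γ.1

/-- `γ ∈ Γ∞ ↔ γ e = e`. [folklore] -/
theorem mem_GammaInf {γ : Sp4Z} : γ ∈ GammaInf ↔ mOf γ *ᵥ e0 = e0 :=
  MulAction.mem_stabilizer_iff

/-- Membership in `Γ∞` is the condition "column `e` equals `e`". [folklore] -/
theorem mem_GammaInf_iff (γ : Sp4Z) :
    γ ∈ GammaInf ↔ (mOf γ) (Sum.inl 0) (Sum.inl 1) = 0 ∧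
      (mOf γ) (Sum.inl 1) (Sum.inl 1) = 1 ∧ (mOf γ) (Sum.inr 0) (Sum.inl 1) = 0 ∧
      (mOf γ) (Sum.inr 1) (Sum.inl 1) = 0 := by
  rw [mem_GammaInf]
  have key : ∀ i, (mOf γ *ᵥ e0) i = (mOf γ) i (Sum.inl 1) := fun i => by
    simp [e0, Matrix.mulVec, dotProduct]
  constructor
  · intro h
    have h' := fun i => (key i).symm.trans (congrFun h i)
    refine ⟨?_, ?_, ?_, ?_⟩
    · simpa [e0] using h' (Sum.inl 0)
    · simpa [e0] using h' (Sum.inl 1)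
    · simpa [e0] using h' (Sum.inr 0)
    · simpa [e0] using h' (Sum.inr 1)
  · rintro ⟨h1, h2, h3, h4⟩
    ext i
    rw [key]
    rcases i with i | i <;> fin_cases i <;> simp [e0, h1, h2, h3, h4]

/-- `-1 ∉ Γ∞`. [folklore] -/
theorem neg_one_not_mem_GammaInf : (-1 : Sp4Z) ∉ GammaInf := by
  rw [mem_GammaInf_iff]
  rintro ⟨-, h, -, -⟩
  simp at h

/-- The integer symplectic relations for `γ ∈ Sp₄(ℤ)`. [folklore] -/
theorem int_rel (γ : Sp4Z) :
    ((mOf γ).toBlocks₁₁)ᵀ * (mOf γ).toBlocks₂₁ = ((mOf γ).toBlocks₂₁)ᵀ * (mOf γ).toBlocks₁₁ ∧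
      ((mOf γ).toBlocks₁₂)ᵀ * (mOf γ).toBlocks₂₂ = ((mOf γ).toBlocks₂₂)ᵀ * (mOf γ).toBlocks₁₂ ∧
      ((mOf γ).toBlocks₁₁)ᵀ * (mOf γ).toBlocks₂₂ - ((mOf γ).toBlocks₂₁)ᵀ * (mOf γ).toBlocks₁₂ = 1 := by
  have h : fromBlocks (mOf γ).toBlocks₁₁ (mOf γ).toBlocks₁₂
      (mOf γ).toBlocks₂₁ (mOf γ).toBlocks₂₂ ∈ Matrix.symplecticGroup (Fin 2) ℤ := by
    rw [fromBlocks_toBlocks]; exact γ.2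
  exact SymplecticGroup.fromBlocks_mem_iff.1 h

/-- **Structure of `Γ∞`**: for `γ ∈ Γ∞` the last row is `(0,0,0,1)`, the `C`-block is
`(c 0; 0 0)`, and `g = (a b₁; c d₁) := (γ₁₁ γ₁₃; γ₃₁ γ₃₃)` has determinant `1`; moreover
`λ := A₁₀ = c B₀₁ - a D₀₁` and `μ := B₁₀ = B₀₁ d₁ - b₁ D₀₁` (the Jacobi parameters). [folklore] -/
theorem GammaInf.structure {γ : Sp4Z} (hγ : γ ∈ GammaInf) :
    (mOf γ) (Sum.inr 1) (Sum.inl 0) = 0 ∧ (mOf γ) (Sum.inr 1) (Sum.inr 0) = 0 ∧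
      (mOf γ) (Sum.inr 1) (Sum.inr 1) = 1 ∧
      (mOf γ) (Sum.inl 0) (Sum.inl 0) * (mOf γ) (Sum.inr 0) (Sum.inr 0) -
        (mOf γ) (Sum.inl 0) (Sum.inr 0) * (mOf γ) (Sum.inr 0) (Sum.inl 0) = 1 ∧
      (mOf γ) (Sum.inl 1) (Sum.inl 0) =
        (mOf γ) (Sum.inr 0) (Sum.inl 0) * (mOf γ) (Sum.inl 0) (Sum.inr 1) -
          (mOf γ) (Sum.inl 0) (Sum.inl 0) * (mOf γ) (Sum.inr 0) (Sum.inr 1) ∧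
      (mOf γ) (Sum.inl 1) (Sum.inr 0) =
        (mOf γ) (Sum.inl 0) (Sum.inr 1) * (mOf γ) (Sum.inr 0) (Sum.inr 0) -
          (mOf γ) (Sum.inl 0) (Sum.inr 0) * (mOf γ) (Sum.inr 0) (Sum.inr 1) := by
  obtain ⟨c1, c2, c3, c4⟩ := (mem_GammaInf_iff γ).1 hγ
  obtain ⟨r1, r2, r3⟩ := int_rel γ
  -- entries of the three relations
  have e1 := congrFun (congrFun r1 1) 0
  have e2 := congrFun (congrFun r3 1) 0
  have e3 := congrFun (congrFun r3 1) 1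
  have e4 := congrFun (congrFun r3 0) 0
  have e5 := congrFun (congrFun r3 0) 1
  have e6 := congrFun (congrFun r2 0) 1
  simp only [Matrix.mul_apply, Fin.sum_univ_two, Matrix.transpose_apply, Matrix.toBlocks₁₁,
    Matrix.toBlocks₁₂, Matrix.toBlocks₂₁, Matrix.toBlocks₂₂, Matrix.of_apply, Matrix.sub_apply,
    Matrix.one_apply_eq, Matrix.one_apply_ne (by decide : (1 : Fin 2) ≠ 0),
    Matrix.one_apply_ne (by decide : (0 : Fin 2) ≠ 1)] at e1 e2 e3 e4 e5 e6
  rw [c1, c2, c3, c4] at *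
  have hC10 : mOf γ (Sum.inr 1) (Sum.inl 0) = 0 := by linarith
  have hD10 : mOf γ (Sum.inr 1) (Sum.inr 0) = 0 := by linarith
  have hD11 : mOf γ (Sum.inr 1) (Sum.inr 1) = 1 := by linarith
  simp only [hC10, hD10, hD11, mul_zero, zero_mul, add_zero, mul_one] at e4 e5 e6
  refine ⟨hC10, hD10, hD11, ?_, ?_, ?_⟩
  · linarith
  · linarith
  · linarith

end Stab

/-! ### Generators of `Γ∞`: Heisenberg elements and the embedded `SL₂(ℤ)` -/

section Generators

open MeasureTheory Set
open scoped MatrixGroups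

/-- The Heisenberg element `heis λ μ κ = ((1 0; λ 1) (0 μ; μ κ); 0 (1 -λ; 0 1))`. [folklore] -/
def heisMat (l m k : ℤ) : Matrix (Fin 2 ⊕ Fin 2) (Fin 2 ⊕ Fin 2) ℤ :=
  fromBlocks !![1, 0; l, 1] !![0, m; m, k] 0 !![1, -l; 0, 1]

/-- `heisMat` is symplectic. [cite: Klingen1990, Ch. I §3 Prop. 6] -/
theorem heisMat_mem (l m k : ℤ) : heisMat l m k ∈ Matrix.symplecticGroup (Fin 2) ℤ := by
  rw [heisMat, SymplecticGroup.fromBlocks_mem_iff]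
  refine ⟨?_, ?_, ?_⟩
  · simp
  · ext i j; fin_cases i <;> fin_cases j <;> simp [Matrix.mul_apply, Fin.sum_univ_two]; ring
  · ext i j; fin_cases i <;> fin_cases j <;> simp [Matrix.mul_apply, Fin.sum_univ_two]

/-- The Heisenberg element as an element of `Sp₄(ℤ)`. [folklore] -/
def heis (l m k : ℤ) : Sp4Z := ⟨heisMat l m k, heisMat_mem l m k⟩

/-- The embedded `SL₂(ℤ)` (on the coordinates `(a₀, b₀)`, Klingen's `M^{(1)}`):
`embMat g = ((a 0; 0 1) (b 0; 0 0); (c 0; 0 0) (d 0; 0 1))`. [folklore] -/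
def embMat (g : SL(2, ℤ)) : Matrix (Fin 2 ⊕ Fin 2) (Fin 2 ⊕ Fin 2) ℤ :=
  fromBlocks !![g 0 0, 0; 0, 1] !![g 0 1, 0; 0, 0] !![g 1 0, 0; 0, 0] !![g 1 1, 0; 0, 1]

/-- `embMat g` is symplectic (Klingen's embedding `M^{(1)}`). [cite: Klingen1990, Ch. I §3 Prop. 6] -/
theorem embMat_mem (g : SL(2, ℤ)) : embMat g ∈ Matrix.symplecticGroup (Fin 2) ℤ := by
  have hdet : g 0 0 * g 1 1 - g 0 1 * g 1 0 = 1 := by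
    have := g.2; rw [Matrix.det_fin_two] at this; linarith
  rw [embMat, SymplecticGroup.fromBlocks_mem_iff]
  refine ⟨?_, ?_, ?_⟩ <;> (ext i j; fin_cases i <;> fin_cases j <;>
    simp [Matrix.mul_apply, Fin.sum_univ_two]) <;> linarith

/-- The embedded `SL₂(ℤ)` element of `Sp₄(ℤ)`. [folklore] -/
def embSL (g : SL(2, ℤ)) : Sp4Z := ⟨embMat g, embMat_mem g⟩

/-- Heisenberg elements fix `e`. [folklore] -/
theorem heis_mem_GammaInf (l m k : ℤ) : heis l m k ∈ GammaInf := by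
  rw [mem_GammaInf_iff]
  simp [heis, mOf, heisMat]

/-- The embedded `SL₂(ℤ)` fixes `e`. [folklore] -/
theorem embSL_mem_GammaInf (g : SL(2, ℤ)) : embSL g ∈ GammaInf := by
  rw [mem_GammaInf_iff]
  simp [embSL, mOf, embMat]

/-- The `SL₂(ℤ)`-part `g = (γ₀₀ γ₀₂; γ₂₀ γ₂₂)` of `γ ∈ Γ∞`. [folklore] -/
def gOf {γ : Sp4Z} (hγ : γ ∈ GammaInf) : SL(2, ℤ) :=
  ⟨!![mOf γ (Sum.inl 0) (Sum.inl 0), mOf γ (Sum.inl 0) (Sum.inr 0);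
      mOf γ (Sum.inr 0) (Sum.inl 0), mOf γ (Sum.inr 0) (Sum.inr 0)], by
    rw [Matrix.det_fin_two_of]
    exact (GammaInf.structure hγ).2.2.2.1⟩

/-- **Decomposition of `Γ∞`** (the Jacobi group `SL₂(ℤ) ⋉ H(ℤ)`): every `γ ∈ Γ∞` is
`heis λ μ κ · embSL g` with `g = gOf γ`, `λ = -γ₂₃`, `μ = γ₀₃`, `κ = γ₁₃`. [folklore] -/
theorem GammaInf.decomp {γ : Sp4Z} (hγ : γ ∈ GammaInf) :
    γ = heis (-(mOf γ (Sum.inr 0) (Sum.inr 1))) (mOf γ (Sum.inl 0) (Sum.inr 1))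
      (mOf γ (Sum.inl 1) (Sum.inr 1)) * embSL (gOf hγ) := by
  obtain ⟨c1, c2, c3, c4⟩ := (mem_GammaInf_iff γ).1 hγ
  obtain ⟨r1, r2, r3, -, r5, r6⟩ := GammaInf.structure hγ
  apply Subtype.ext
  rw [Submonoid.coe_mul]
  change mOf γ = heisMat _ _ _ * embMat _
  ext i j
  rcases i with i | i <;> rcases j with j | j <;> fin_cases i <;> fin_cases j <;>
    simp [heisMat, embMat, gOf, Matrix.mul_apply, Fin.sum_univ_two, fromBlocks, c1, c2, c3, c4,
      r1, r2, r3]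
  · linarith
  · linarith

/-! #### Coordinate actions -/

variable {x : Fin 6 → ℝ}

/-- `A`-block of a Heisenberg element. [folklore] -/
theorem cA_heis (l m k : ℤ) : cA (toR (heis l m k)) = !![(1 : ℂ), 0; (l : ℂ), 1] := by
  unfold cA blkA; rw [coe_toR]
  change ((heisMat l m k).map (Int.castRingHom ℝ)).toBlocks₁₁.map _ = _
  rw [heisMat, Matrix.fromBlocks_map, Matrix.toBlocks_fromBlocks₁₁]
  ext i j; fin_cases i <;> fin_cases j <;> simp

/-- `B`-block of a Heisenberg element. [folklore] -/
theorem cB_heis (l m k : ℤ) : cB (toR (heis l m k)) = !![(0 : ℂ), (m : ℂ); (m : ℂ), (k : ℂ)] := by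
  unfold cB blkB; rw [coe_toR]
  change ((heisMat l m k).map (Int.castRingHom ℝ)).toBlocks₁₂.map _ = _
  rw [heisMat, Matrix.fromBlocks_map, Matrix.toBlocks_fromBlocks₁₂]
  ext i j; fin_cases i <;> fin_cases j <;> simp

/-- `C`-block of a Heisenberg element. [folklore] -/
theorem cC_heis (l m k : ℤ) : cC (toR (heis l m k)) = 0 := by
  unfold cC blkC; rw [coe_toR]
  change ((heisMat l m k).map (Int.castRingHom ℝ)).toBlocks₂₁.map _ = _
  rw [heisMat, Matrix.fromBlocks_map, Matrix.toBlocks_fromBlocks₂₁]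
  ext i j; fin_cases i <;> fin_cases j <;> simp

/-- `D`-block of a Heisenberg element. [folklore] -/
theorem cD_heis (l m k : ℤ) : cD (toR (heis l m k)) = !![(1 : ℂ), -(l : ℂ); 0, 1] := by
  unfold cD blkD; rw [coe_toR]
  change ((heisMat l m k).map (Int.castRingHom ℝ)).toBlocks₂₂.map _ = _
  rw [heisMat, Matrix.fromBlocks_map, Matrix.toBlocks_fromBlocks₂₂]
  ext i j; fin_cases i <;> fin_cases j <;> simp

/-- **The Heisenberg element in coordinates**:
`(x₀, x₁, x₂, x₃, x₄, x₅) ↦ (x₀, x₁ + λx₀ + μ, x₂ + λ²x₀ + 2λx₁ + λμ + κ, x₃, x₄ + λx₃, x₅ + λ²x₃ + 2λx₄)`. [folklore] -/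
theorem smulVec_heis (l m k : ℤ) (x : Fin 6 → ℝ) :
    smulVec (toR (heis l m k)) x =
      ![x 0, x 1 + l * x 0 + m, x 2 + l ^ 2 * x 0 + 2 * l * x 1 + l * m + k, x 3, x 4 + l * x 3,
        x 5 + l ^ 2 * x 3 + 2 * l * x 4] := by
  have hinv : ((!![(1 : ℂ), -(l : ℂ); 0, 1] : Matrix (Fin 2) (Fin 2) ℂ))⁻¹ = !![(1 : ℂ), (l : ℂ); 0, 1] := by
    apply Matrix.inv_eq_left_inv
    ext i j; fin_cases i <;> fin_cases j <;> simp [Matrix.mul_apply, Fin.sum_univ_two]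
  unfold smulVec smulZ matP matQ
  rw [cA_heis, cB_heis, cC_heis, cD_heis, Matrix.zero_mul, zero_add, hinv]
  ext i
  fin_cases i <;> simp [ofZ, toZ, Matrix.mul_apply, Fin.sum_univ_two] <;> ring

end Generators

section EmbSL

open MeasureTheory Set
open scoped MatrixGroups UpperHalfPlane

variable {x : Fin 6 → ℝ}

/-- `A`-block of an embedded element. [folklore] -/
theorem cA_embSL (g : SL(2, ℤ)) : cA (toR (embSL g)) = !![((g 0 0 : ℤ) : ℂ), 0; 0, 1] := by
  unfold cA blkA; rw [coe_toR]
  change ((embMat g).map (Int.castRingHom ℝ)).toBlocks₁₁.map _ = _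
  rw [embMat, Matrix.fromBlocks_map, Matrix.toBlocks_fromBlocks₁₁]
  ext i j; fin_cases i <;> fin_cases j <;> simp

/-- `B`-block of an embedded element. [folklore] -/
theorem cB_embSL (g : SL(2, ℤ)) : cB (toR (embSL g)) = !![((g 0 1 : ℤ) : ℂ), 0; 0, 0] := by
  unfold cB blkB; rw [coe_toR]
  change ((embMat g).map (Int.castRingHom ℝ)).toBlocks₁₂.map _ = _
  rw [embMat, Matrix.fromBlocks_map, Matrix.toBlocks_fromBlocks₁₂]
  ext i j; fin_cases i <;> fin_cases j <;> simp

/-- `C`-block of an embedded element. [folklore] -/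
theorem cC_embSL (g : SL(2, ℤ)) : cC (toR (embSL g)) = !![((g 1 0 : ℤ) : ℂ), 0; 0, 0] := by
  unfold cC blkC; rw [coe_toR]
  change ((embMat g).map (Int.castRingHom ℝ)).toBlocks₂₁.map _ = _
  rw [embMat, Matrix.fromBlocks_map, Matrix.toBlocks_fromBlocks₂₁]
  ext i j; fin_cases i <;> fin_cases j <;> simp

/-- `D`-block of an embedded element. [folklore] -/
theorem cD_embSL (g : SL(2, ℤ)) : cD (toR (embSL g)) = !![((g 1 1 : ℤ) : ℂ), 0; 0, 1] := by
  unfold cD blkD; rw [coe_toR]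
  change ((embMat g).map (Int.castRingHom ℝ)).toBlocks₂₂.map _ = _
  rw [embMat, Matrix.fromBlocks_map, Matrix.toBlocks_fromBlocks₂₂]
  ext i j; fin_cases i <;> fin_cases j <;> simp

/-- The automorphy denominator `j = c z₁₁ + d` of the embedded element. [folklore] -/
def jden (g : SL(2, ℤ)) (x : Fin 6 → ℝ) : ℂ := ((g 1 0 : ℤ) : ℂ) * ((x 0 : ℂ) + x 3 * Complex.I) + ((g 1 1 : ℤ) : ℂ)

/-- `c z₁₁ + d ≠ 0` on `H₂`. [folklore] -/
theorem jden_ne_zero (g : SL(2, ℤ)) (hx : x ∈ U) : jden g x ≠ 0 := by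
  have hdet : g 0 0 * g 1 1 - g 0 1 * g 1 0 = 1 := by
    have := g.2; rw [Matrix.det_fin_two] at this; linarith
  intro h
  have him := congrArg Complex.im h
  have hre := congrArg Complex.re h
  simp [jden] at him hre
  have h3 : x 3 ≠ 0 := hx.1.ne'
  have hc : (g 1 0 : ℝ) = 0 := by
    rcases him with h | h
    · exact_mod_cast h
    · exact absurd h h3
  have hc' : g 1 0 = 0 := by exact_mod_cast hc
  rw [hc, zero_mul, zero_add] at hre
  have hd : g 1 1 = 0 := by exact_mod_cast hre
  rw [hc', hd] at hdet
  simp at hdet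

/-- `Q = CZ + D` for the embedded element is `(j, c z₁₂; 0, 1)`. [folklore] -/
theorem matQ_embSL (g : SL(2, ℤ)) (x : Fin 6 → ℝ) :
    matQ (toR (embSL g)) x =
      !![jden g x, ((g 1 0 : ℤ) : ℂ) * ((x 1 : ℂ) + x 4 * Complex.I); 0, 1] := by
  unfold matQ
  rw [cC_embSL, cD_embSL, toZ]
  ext i j; fin_cases i <;> fin_cases j <;> simp [jden]

/-- The inverse of `Q = CZ + D` for an embedded element. [folklore] -/
theorem matQ_embSL_inv (g : SL(2, ℤ)) (hx : x ∈ U) :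
    (matQ (toR (embSL g)) x)⁻¹ =
      !![(jden g x)⁻¹, -((g 1 0 : ℤ) : ℂ) * ((x 1 : ℂ) + x 4 * Complex.I) * (jden g x)⁻¹; 0, 1] := by
  have hj := jden_ne_zero g hx
  rw [matQ_embSL]
  apply Matrix.inv_eq_left_inv
  ext i j
  fin_cases i <;> fin_cases j <;> simp [Matrix.mul_apply, Fin.sum_univ_two] <;> field_simp
  ring

/-- **The embedded `SL₂(ℤ)` element on matrices**:
`g⟨Z⟩ = ((a z₁₁ + b)/j, z₁₂/j; z₁₂/j, z₂₂ - c z₁₂²/j)`, `j = c z₁₁ + d` (the Jacobi-type action). [folklore] -/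
theorem smulZ_embSL (g : SL(2, ℤ)) (hx : x ∈ U) :
    smulZ (toR (embSL g)) x =
      !![(((g 0 0 : ℤ) : ℂ) * ((x 0 : ℂ) + x 3 * Complex.I) + ((g 0 1 : ℤ) : ℂ)) * (jden g x)⁻¹,
          ((x 1 : ℂ) + x 4 * Complex.I) * (jden g x)⁻¹;
         ((x 1 : ℂ) + x 4 * Complex.I) * (jden g x)⁻¹,
          ((x 2 : ℂ) + x 5 * Complex.I) - ((g 1 0 : ℤ) : ℂ) * ((x 1 : ℂ) + x 4 * Complex.I) ^ 2 * (jden g x)⁻¹] := by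
  have hj := jden_ne_zero g hx
  have hdet : (g 0 0 : ℂ) * g 1 1 - (g 0 1 : ℂ) * g 1 0 = 1 := by
    have := g.2; rw [Matrix.det_fin_two] at this; exact_mod_cast this
  have hjdef : jden g x = ((g 1 0 : ℤ) : ℂ) * ((x 0 : ℂ) + x 3 * Complex.I) + ((g 1 1 : ℤ) : ℂ) := rfl
  unfold smulZ matP
  rw [matQ_embSL_inv g hx, cA_embSL, cB_embSL, toZ]
  ext i j
  fin_cases i <;> fin_cases j <;> simp [Matrix.mul_apply, Fin.sum_univ_two]
  · field_simp
    rw [hjdef]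
    linear_combination ((x 1 : ℂ) + x 4 * Complex.I) * hdet
  · ring

/-- `ρ(p) = x₀ + i x₃ ∈ ℍ`. [folklore] -/
def rho (p : U) : ℍ := UpperHalfPlane.mk ⟨p.1 0, p.1 3⟩ p.2.1

/-- `ρ(p) = x₀ + i x₃` as a complex number. [folklore] -/
@[simp] theorem coe_rho (p : U) : ((rho p : ℍ) : ℂ) = (p.1 0 : ℂ) + p.1 3 * I := by
  rw [rho]; apply Complex.ext <;> simp

/-- **`ρ` is equivariant for the embedded `SL₂(ℤ)`**: `ρ(embSL g • p) = g • ρ(p)`. [folklore] -/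
theorem rho_embSL_smul (g : SL(2, ℤ)) (p : U) : rho (embSL g • p) = g • rho p := by
  apply UpperHalfPlane.ext
  rw [UpperHalfPlane.coe_specialLinearGroup_apply, coe_rho, coe_rho]
  have hx := p.2
  have h := congrArg (fun W : Matrix (Fin 2) (Fin 2) ℂ => W 0 0) (smulZ_embSL g hx)
  simp only [Matrix.of_apply, Matrix.cons_val', Matrix.cons_val_zero, Matrix.empty_val',
    Matrix.cons_val_fin_one] at h
  have e0 : (smulVec (toR (embSL g)) p.1 0 : ℂ) + smulVec (toR (embSL g)) p.1 3 * Complex.I =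
      smulZ (toR (embSL g)) p.1 0 0 := by
    conv_rhs => rw [← toZ_smulVec _ hx]
    simp [toZ]
  change (smulVec (toR (embSL g)) p.1 0 : ℂ) + smulVec (toR (embSL g)) p.1 3 * Complex.I = _
  rw [e0, h, jden, div_eq_mul_inv]
  simp

/-- **The element `embSL (-1)` in coordinates**: `(x₀, x₁, x₂, x₃, x₄, x₅) ↦ (x₀, -x₁, x₂, x₃, -x₄, x₅)`. [folklore] -/
theorem smulVec_embSL_neg_one (hx : x ∈ U) :
    smulVec (toR (embSL (-1))) x = ![x 0, -x 1, x 2, x 3, -x 4, x 5] := by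
  have h := smulZ_embSL (-1) hx
  have hj : jden (-1) x = -1 := by simp [jden]
  rw [hj] at h
  unfold smulVec
  rw [h]
  ext i
  fin_cases i <;> simp [ofZ]

end EmbSL

/-! ### The domain `𝓓∞` of `Γ∞` and its fundamental-domain property -/

section DInf

open MeasureTheory Set
open scoped MatrixGroups UpperHalfPlane Modular ENNReal

/-- `u₂ = x₄/x₃`. [folklore] -/
def u2 (x : Fin 6 → ℝ) : ℝ := x 4 / x 3
/-- `u₁ = x₀x₄/x₃ - x₁`. [folklore] -/
def u1 (x : Fin 6 → ℝ) : ℝ := x 0 * x 4 / x 3 - x 1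

/-- **The domain `𝓓∞`** of `Γ∞` in the coordinates `(ρ, u₁, u₂, t₁, t)`:
`ρ ∈ 𝒟` (the standard fundamental domain of `SL₂(ℤ)`), `u₂ ∈ [0, 1/2]`, `u₁ ∈ [0, 1)`,
`t₁ = x₂ ∈ [0, 1)`. [folklore] -/
def DInf : Set U :=
  {p | rho p ∈ 𝒟 ∧ u2 p.1 ∈ Icc (0 : ℝ) (1 / 2) ∧ u1 p.1 ∈ Ico (0 : ℝ) 1 ∧ p.1 2 ∈ Ico (0 : ℝ) 1}

/-- The coordinates of `γ • p`. [folklore] -/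
theorem coe_sp4Z_smul (γ : Sp4Z) (p : U) : ((γ • p : U) : Fin 6 → ℝ) = smulVec (toR γ) p.1 := rfl

/-! #### Effect of the generators on the coordinates -/

/-- Heisenberg elements fix `ρ`. [folklore] -/
theorem rho_heis (l m k : ℤ) (p : U) : rho (heis l m k • p) = rho p := by
  apply UpperHalfPlane.ext
  rw [coe_rho, coe_rho, coe_sp4Z_smul, smulVec_heis]
  simp

/-- Heisenberg elements translate `u₂` by `λ`. [folklore] -/
theorem u2_heis (l m k : ℤ) (p : U) : u2 (heis l m k • p : U).1 = u2 p.1 + l := by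
  have h3 : p.1 3 ≠ 0 := p.2.1.ne'
  rw [coe_sp4Z_smul, smulVec_heis, u2, u2]
  simp only [Matrix.cons_val]
  field_simp

/-- Heisenberg elements translate `u₁` by `-μ`. [folklore] -/
theorem u1_heis (l m k : ℤ) (p : U) : u1 (heis l m k • p : U).1 = u1 p.1 - m := by
  have h3 : p.1 3 ≠ 0 := p.2.1.ne'
  rw [coe_sp4Z_smul, smulVec_heis, u1, u1]
  simp only [Matrix.cons_val]
  field_simp
  ring

/-- Heisenberg elements on `t₁ = x₂`. [folklore] -/
theorem x2_heis (l m k : ℤ) (p : U) :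
    (heis l m k • p : U).1 2 = p.1 2 + l ^ 2 * p.1 0 + 2 * l * p.1 1 + l * m + k := by
  rw [coe_sp4Z_smul, smulVec_heis]
  simp

/-- `embSL (-1)` fixes `ρ`. [folklore] -/
theorem rho_embSL_neg_one (p : U) : rho (embSL (-1) • p) = rho p := by
  rw [rho_embSL_smul]; simp

/-- `embSL (-1)` negates `u₂`. [folklore] -/
theorem u2_embSL_neg_one (p : U) : u2 (embSL (-1) • p : U).1 = -u2 p.1 := by
  rw [coe_sp4Z_smul, smulVec_embSL_neg_one p.2, u2, u2]
  simp [neg_div]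

/-- `embSL (-1)` negates `u₁`. [folklore] -/
theorem u1_embSL_neg_one (p : U) : u1 (embSL (-1) • p : U).1 = -u1 p.1 := by
  rw [coe_sp4Z_smul, smulVec_embSL_neg_one p.2, u1, u1]
  simp; ring

/-- `embSL (-1)` fixes `t₁ = x₂`. [folklore] -/
theorem x2_embSL_neg_one (p : U) : (embSL (-1) • p : U).1 2 = p.1 2 := by
  rw [coe_sp4Z_smul, smulVec_embSL_neg_one p.2]
  simp

/-! #### Every orbit meets `𝓓∞` -/

/-- **Covering**: every `Γ∞`-orbit meets `𝓓∞`. [folklore] -/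
theorem DInf_covers (p : U) : ∃ γ ∈ GammaInf, γ • p ∈ DInf := by
  -- step 1: move ρ into 𝒟
  obtain ⟨g, hg⟩ := ModularGroup.exists_smul_mem_fd (rho p)
  set p₁ : U := embSL g • p with hp₁
  have hρ₁ : rho p₁ ∈ 𝒟 := by rw [hp₁, rho_embSL_smul]; exact hg
  -- step 2: u₂ into [0,1)
  set l : ℤ := -⌊u2 p₁.1⌋ with hl
  set p₂ : U := heis l 0 0 • p₁ with hp₂
  have hρ₂ : rho p₂ ∈ 𝒟 := by rw [hp₂, rho_heis]; exact hρ₁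
  have hu₂ : u2 p₂.1 ∈ Ico (0 : ℝ) 1 := by
    rw [hp₂, u2_heis, hl, Int.cast_neg, ← sub_eq_add_neg]
    exact ⟨Int.fract_nonneg _, Int.fract_lt_one _⟩
  -- step 3: u₂ into [0, 1/2]
  obtain ⟨γ₃, hγ₃, p₃, hp₃, hρ₃, hu₃⟩ : ∃ γ₃ ∈ GammaInf, ∃ p₃ : U, p₃ = γ₃ • p₂ ∧ rho p₃ ∈ 𝒟 ∧
      u2 p₃.1 ∈ Icc (0 : ℝ) (1 / 2) := by
    by_cases h : u2 p₂.1 ≤ 1 / 2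
    · exact ⟨1, GammaInf.one_mem, p₂, (one_smul _ _).symm, hρ₂, hu₂.1, h⟩
    · refine ⟨heis 1 0 0 * embSL (-1), GammaInf.mul_mem (heis_mem_GammaInf 1 0 0)
        (embSL_mem_GammaInf (-1)), (heis 1 0 0 * embSL (-1)) • p₂, rfl, ?_, ?_⟩
      · rw [mul_smul, rho_heis, rho_embSL_neg_one]; exact hρ₂
      · rw [mul_smul, u2_heis, u2_embSL_neg_one]
        push Not at h
        constructor
        · have := hu₂.2; push_cast; linarith
        · push_cast; linarith
  -- step 4: u₁ into [0,1)
  set m : ℤ := ⌊u1 p₃.1⌋ with hm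
  set p₄ : U := heis 0 m 0 • p₃ with hp₄
  have hρ₄ : rho p₄ ∈ 𝒟 := by rw [hp₄, rho_heis]; exact hρ₃
  have hu2₄ : u2 p₄.1 ∈ Icc (0 : ℝ) (1 / 2) := by rw [hp₄, u2_heis, Int.cast_zero, add_zero]; exact hu₃
  have hu1₄ : u1 p₄.1 ∈ Ico (0 : ℝ) 1 := by
    rw [hp₄, u1_heis, hm]
    exact ⟨Int.fract_nonneg _, Int.fract_lt_one _⟩
  -- step 5: x₂ into [0,1)
  set k : ℤ := -⌊p₄.1 2⌋ with hk
  set p₅ : U := heis 0 0 k • p₄ with hp₅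
  have hρ₅ : rho p₅ ∈ 𝒟 := by rw [hp₅, rho_heis]; exact hρ₄
  have hu2₅ : u2 p₅.1 ∈ Icc (0 : ℝ) (1 / 2) := by rw [hp₅, u2_heis, Int.cast_zero, add_zero]; exact hu2₄
  have hu1₅ : u1 p₅.1 ∈ Ico (0 : ℝ) 1 := by rw [hp₅, u1_heis, Int.cast_zero, sub_zero]; exact hu1₄
  have hx2₅ : p₅.1 2 ∈ Ico (0 : ℝ) 1 := by
    rw [hp₅, x2_heis, hk]
    simp only [Int.cast_zero, zero_pow two_ne_zero, zero_mul, mul_zero, add_zero, Int.cast_neg]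
    rw [← sub_eq_add_neg]
    exact ⟨Int.fract_nonneg _, Int.fract_lt_one _⟩
  refine ⟨heis 0 0 k * heis 0 m 0 * γ₃ * heis l 0 0 * embSL g, ?_, ?_⟩
  · exact GammaInf.mul_mem (GammaInf.mul_mem (GammaInf.mul_mem (GammaInf.mul_mem
      (heis_mem_GammaInf 0 0 k) (heis_mem_GammaInf 0 m 0)) hγ₃) (heis_mem_GammaInf l 0 0))
      (embSL_mem_GammaInf g)
  · have : (heis 0 0 k * heis 0 m 0 * γ₃ * heis l 0 0 * embSL g) • p = p₅ := by
      rw [hp₅, hp₄, hp₃, hp₂, hp₁]; simp only [mul_smul]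
    rw [this]
    exact ⟨hρ₅, hu2₅, hu1₅, hx2₅⟩

/-! #### Uniqueness off a null set -/

/-- `embSL 1 = 1`. [folklore] -/
theorem embSL_one : embSL 1 = 1 := by
  apply Subtype.ext
  change embMat 1 = 1
  ext i j
  rcases i with i | i <;> rcases j with j | j <;> fin_cases i <;> fin_cases j <;>
    simp [embMat]

/-- `heis 0 0 0 = 1`. [folklore] -/
theorem heis_zero : heis 0 0 0 = 1 := by
  apply Subtype.ext
  change heisMat 0 0 0 = 1
  ext i j
  rcases i with i | i <;> rcases j with j | j <;> fin_cases i <;> fin_cases j <;>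
    simp [heisMat]

/-- **Uniqueness**: if `p, γ p ∈ 𝓓∞` with `γ ∈ Γ∞`, `ρ(p) ∈ 𝒟ᵒ` and `u₂(p) ∉ {0, 1/2}`, then
`γ = 1`. [folklore] -/
theorem DInf_unique {p : U} (hp : p ∈ DInf) (hρo : rho p ∈ 𝒟ᵒ) (hu0 : u2 p.1 ≠ 0)
    (hu12 : u2 p.1 ≠ 1 / 2) {γ : Sp4Z} (hγ : γ ∈ GammaInf) (hγp : γ • p ∈ DInf) : γ = 1 := by
  obtain ⟨-, hpu2, hpu1, hpx2⟩ := hp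
  have hdec := GammaInf.decomp hγ
  set l : ℤ := -(mOf γ (Sum.inr 0) (Sum.inr 1))
  set m : ℤ := mOf γ (Sum.inl 0) (Sum.inr 1)
  set k : ℤ := mOf γ (Sum.inl 1) (Sum.inr 1)
  set g : SL(2, ℤ) := gOf hγ
  obtain ⟨hρ', hu2', hu1', hx2'⟩ := hγp
  rw [hdec, mul_smul, rho_heis, rho_embSL_smul] at hρ'
  rcases ModularGroup.eq_one_or_neg_one_of_mem_fdo_mem_fd hρo hρ' with h1 | h1
  · -- g = 1: γ = heis l m k
    rw [h1, embSL_one, mul_one] at hdec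
    rw [hdec, u2_heis] at hu2'
    have hl : l = 0 := by
      have h1' : (l : ℝ) ≤ 1 / 2 := by linarith [hu2'.2, hpu2.1]
      have h2' : (-(1 : ℝ)) / 2 ≤ l := by linarith [hu2'.1, hpu2.2]
      have a : (l : ℝ) < 1 := by linarith
      have b : (-1 : ℝ) < l := by linarith
      have a' : l < 1 := by exact_mod_cast a
      have b' : -1 < l := by exact_mod_cast b
      omega
    rw [hdec, u1_heis] at hu1'
    have hm : m = 0 := by
      have a : (m : ℝ) < 1 := by linarith [hu1'.1, hpu1.2]
      have b : (-1 : ℝ) < m := by linarith [hu1'.2, hpu1.1]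
      have a' : m < 1 := by exact_mod_cast a
      have b' : -1 < m := by exact_mod_cast b
      omega
    rw [hdec, x2_heis, hl, hm] at hx2'
    simp only [Int.cast_zero, zero_pow two_ne_zero, zero_mul, mul_zero, add_zero] at hx2'
    have hk : k = 0 := by
      have a : (k : ℝ) < 1 := by linarith [hx2'.2, hpx2.1]
      have b : (-1 : ℝ) < k := by linarith [hx2'.1, hpx2.2]
      have a' : k < 1 := by exact_mod_cast a
      have b' : -1 < k := by exact_mod_cast b
      omega
    rw [hdec, hl, hm, hk, heis_zero]
  · -- g = -1: impossible off the null set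
    exfalso
    rw [h1] at hdec
    rw [hdec, mul_smul, u2_heis, u2_embSL_neg_one] at hu2'
    -- -u2 + l ∈ [0, 1/2], u2 ∈ [0, 1/2], u2 ≠ 0, 1/2 ⟹ 0 < l < 1
    have hu2pos : 0 < u2 p.1 := lt_of_le_of_ne hpu2.1 (Ne.symm hu0)
    have hu2lt : u2 p.1 < 1 / 2 := lt_of_le_of_ne hpu2.2 hu12
    have a : (0 : ℝ) < l := by linarith [hu2'.1]
    have b : (l : ℝ) < 1 := by linarith [hu2'.2]
    have a' : 0 < l := by exact_mod_cast a
    have b' : l < 1 := by exact_mod_cast b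
    omega

end DInf

/-! ### Null sets for the symplectic volume and `IsSiegelFD Γ∞ 𝓓∞` -/

section NullSets

open MeasureTheory Set
open scoped MatrixGroups UpperHalfPlane Modular ENNReal

/-- A set of `H₂` whose image in `ℝ⁶` is Lebesgue-null is `siegelVolume`-null. [folklore] -/
theorem siegelVolume_null {S : Set U} (h : volume (Subtype.val '' S) = 0) : siegelVolume S = 0 := by
  unfold siegelVolume
  apply withDensity_absolutelyContinuous
  rw [measurableEmbedding_val.comap_apply]
  exact h

/-- The index pair `{0, 3}` as a subtype equivalent to `Fin 2`. [folklore] -/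
def idx03 : Fin 2 ≃ {i : Fin 6 // i = 0 ∨ i = 3} where
  toFun k := if k = 0 then ⟨0, Or.inl rfl⟩ else ⟨3, Or.inr rfl⟩
  invFun i := if i.1 = 0 then 0 else 1
  left_inv k := by fin_cases k <;> simp
  right_inv i := by
    obtain ⟨i, hi | hi⟩ := i <;> subst hi
    · simp
    · simp only; rw [if_neg (by decide)]

/-- **A cylinder over a Lebesgue-null set of the `(x₀, x₃)`-plane is Lebesgue-null in `ℝ⁶`.** [folklore] -/
theorem volume_cylinder_null {N : Set (ℝ × ℝ)} (hN : volume N = 0) :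
    volume {x : Fin 6 → ℝ | (x 0, x 3) ∈ N} = 0 := by
  classical
  set pr : Fin 6 → Prop := fun i => i = 0 ∨ i = 3 with hpr
  have e1 := volume_preserving_piEquivPiSubtypeProd (fun _ : Fin 6 => ℝ) pr
  -- the null set in the first factor
  set N' : Set ({i : Fin 6 // pr i} → ℝ) := {y | (y ⟨0, Or.inl rfl⟩, y ⟨3, Or.inr rfl⟩) ∈ N} with hN'
  have hS : {x : Fin 6 → ℝ | (x 0, x 3) ∈ N} =
      (MeasurableEquiv.piEquivPiSubtypeProd (fun _ : Fin 6 => ℝ) pr) ⁻¹' (N' ×ˢ univ) := by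
    ext x
    simp [hN', MeasurableEquiv.piEquivPiSubtypeProd, Equiv.piEquivPiSubtypeProd]
  rw [hS, e1.measure_preimage_equiv, Measure.volume_eq_prod, Measure.prod_prod]
  -- volume N' = 0 via the equivalence with ℝ × ℝ
  set e : ({i : Fin 6 // pr i} → ℝ) ≃ᵐ ℝ × ℝ :=
    (MeasurableEquiv.piCongrLeft (fun _ : {i : Fin 6 // pr i} => ℝ) idx03).symm.trans
      MeasurableEquiv.finTwoArrow with he
  have e2 := (volume_measurePreserving_piCongrLeft (fun _ : {i : Fin 6 // pr i} => ℝ) idx03).symm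
  have e3 := volume_preserving_finTwoArrow ℝ
  have e23 : MeasurePreserving e volume volume := e3.comp e2
  have hN'eq : N' = e ⁻¹' N := by
    ext y
    simp [hN', he, MeasurableEquiv.finTwoArrow, MeasurableEquiv.piCongrLeft, Equiv.piCongrLeft, idx03]
  have hvolN' : volume N' = 0 := by
    rw [hN'eq, e23.measure_preimage_equiv]; exact hN
  rw [hvolN', zero_mul]

end NullSets

section NullSets2

open MeasureTheory Set
open scoped MatrixGroups UpperHalfPlane Modular ENNReal

/-- The lines `|a| = 1/2` and the unit circle are Lebesgue-null in `ℝ²`. [folklore] -/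
theorem volume_lines_circle_null :
    volume {q : ℝ × ℝ | |q.1| = 1 / 2 ∨ q.1 ^ 2 + q.2 ^ 2 = 1} = 0 := by
  have h1 : volume {q : ℝ × ℝ | |q.1| = 1 / 2} = 0 := by
    have : {q : ℝ × ℝ | |q.1| = 1 / 2} = ({(1 / 2 : ℝ), -(1 / 2)} : Set ℝ) ×ˢ (univ : Set ℝ) := by
      ext q
      simp only [mem_setOf_eq, mem_prod, mem_insert_iff, mem_singleton_iff, mem_univ, and_true]
      constructor
      · intro h
        rcases abs_eq (by norm_num : (0 : ℝ) ≤ 1 / 2) |>.1 h with h' | h'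
        · exact Or.inl h'
        · exact Or.inr h'
      · rintro (h | h) <;> rw [h] <;> norm_num
    rw [this, Measure.volume_eq_prod, Measure.prod_prod]
    have : volume ({(1 / 2 : ℝ), -(1 / 2)} : Set ℝ) = 0 :=
      (Set.toFinite _).measure_zero volume
    rw [this, zero_mul]
  have h2 : volume {q : ℝ × ℝ | q.1 ^ 2 + q.2 ^ 2 = 1} = 0 := by
    have hs : {q : ℝ × ℝ | q.1 ^ 2 + q.2 ^ 2 = 1} =
        Complex.measurableEquivRealProd.symm ⁻¹' Metric.sphere (0 : ℂ) 1 := by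
      ext q
      simp only [mem_setOf_eq, mem_preimage, Metric.mem_sphere, dist_zero_right,
        Complex.measurableEquivRealProd_symm_apply, Complex.norm_eq_sqrt_sq_add_sq]
      rw [Real.sqrt_eq_one]
    rw [hs, Complex.volume_preserving_equiv_real_prod.symm.measure_preimage_equiv]
    exact Measure.addHaar_sphere volume (0 : ℂ) 1
  have : {q : ℝ × ℝ | |q.1| = 1 / 2 ∨ q.1 ^ 2 + q.2 ^ 2 = 1} =
      {q : ℝ × ℝ | |q.1| = 1 / 2} ∪ {q | q.1 ^ 2 + q.2 ^ 2 = 1} := by ext q; simp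
  rw [this]
  exact measure_union_null h1 h2

/-- The hyperplane `x₄ = c · x₃` is Lebesgue-null in `ℝ⁶`. [folklore] -/
theorem volume_hyperplane_null (c : ℝ) : volume {x : Fin 6 → ℝ | x 4 = c * x 3} = 0 := by
  set L : (Fin 6 → ℝ) →ₗ[ℝ] ℝ := LinearMap.proj 4 - c • LinearMap.proj 3 with hL
  have hker : {x : Fin 6 → ℝ | x 4 = c * x 3} = (LinearMap.ker L : Set (Fin 6 → ℝ)) := by
    ext x
    simp [hL, sub_eq_zero]
  rw [hker]
  apply Measure.addHaar_submodule
  intro htop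
  have hmem : (Pi.single 4 1 : Fin 6 → ℝ) ∈ LinearMap.ker L := by rw [htop]; trivial
  simp [hL] at hmem

/-- The exceptional set of `𝓓∞`. [folklore] -/
def badSet : Set U :=
  {p | rho p ∉ 𝒟ᵒ ∧ rho p ∈ 𝒟} ∪ {p | u2 p.1 = 0} ∪ {p | u2 p.1 = 1 / 2}

/-- The exceptional set of `𝓓∞` is null. [folklore] -/
theorem siegelVolume_badSet : siegelVolume badSet = 0 := by
  apply siegelVolume_null
  have hsub : Subtype.val '' badSet ⊆
      {x : Fin 6 → ℝ | (x 0, x 3) ∈ {q : ℝ × ℝ | |q.1| = 1 / 2 ∨ q.1 ^ 2 + q.2 ^ 2 = 1}} ∪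
        {x | x 4 = 0 * x 3} ∪ {x | x 4 = (1 / 2) * x 3} := by
    rintro _ ⟨p, hp, rfl⟩
    have h3 : p.1 3 ≠ 0 := p.2.1.ne'
    rcases hp with (⟨hno, hfd⟩ | hu) | hu
    · left; left
      have hc : ((rho p : ℍ) : ℂ) = (p.1 0 : ℂ) + p.1 3 * Complex.I := coe_rho p
      have hns : Complex.normSq ((rho p : ℍ) : ℂ) = p.1 0 ^ 2 + p.1 3 ^ 2 := by
        rw [hc, Complex.normSq_apply]; simp; ring
      have hre : (rho p).re = p.1 0 := by rw [← UpperHalfPlane.coe_re, hc]; simp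
      simp only [ModularGroup.fdo, ModularGroup.fd, mem_setOf_eq, not_and_or, not_lt, hns, hre]
        at hno hfd
      show |p.1 0| = 1 / 2 ∨ p.1 0 ^ 2 + p.1 3 ^ 2 = 1
      rcases hno with h | h
      · right; linarith [hfd.1]
      · left; exact le_antisymm hfd.2 h
    · left; right
      simp only [mem_setOf_eq, u2, div_eq_zero_iff] at hu ⊢
      rcases hu with h | h
      · rw [h]; ring
      · exact absurd h h3
    · right
      simp only [mem_setOf_eq, u2] at hu ⊢
      field_simp at hu
      linarith
  refine measure_mono_null hsub ?_
  refine measure_union_null (measure_union_null ?_ (volume_hyperplane_null 0)) (volume_hyperplane_null _)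
  exact volume_cylinder_null volume_lines_circle_null

end NullSets2

section DInfFD

open MeasureTheory Set
open scoped MatrixGroups UpperHalfPlane Modular ENNReal

/-- `ρ` is measurable. [folklore] -/
theorem measurable_rho : Measurable (rho : U → ℍ) := by
  rw [← UpperHalfPlane.measurableEmbedding_coe.measurable_comp_iff]
  have : (UpperHalfPlane.coe ∘ rho) = fun p : U => ((p.1 0 : ℂ) + p.1 3 * Complex.I) :=
    funext coe_rho
  rw [this]
  have h0 : Measurable fun p : U => (p.1 0 : ℝ) := (measurable_pi_apply 0).comp measurable_subtype_coe
  have h3 : Measurable fun p : U => (p.1 3 : ℝ) := (measurable_pi_apply 3).comp measurable_subtype_coe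
  exact (Complex.measurable_ofReal.comp h0).add ((Complex.measurable_ofReal.comp h3).mul_const _)

/-- `u₂` is measurable. [folklore] -/
theorem measurable_u2 : Measurable u2 := by unfold u2; fun_prop
/-- `u₁` is measurable. [folklore] -/
theorem measurable_u1 : Measurable u1 := by unfold u1; fun_prop

/-- `𝓓∞` is measurable. [folklore] -/
theorem measurableSet_DInf : MeasurableSet DInf := by
  have h1 : MeasurableSet {p : U | rho p ∈ 𝒟} :=
    measurable_rho ModularGroup.isClosed_fd.measurableSet
  have h2 : MeasurableSet {p : U | u2 p.1 ∈ Icc (0 : ℝ) (1 / 2)} :=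
    (measurable_u2.comp measurable_subtype_coe) measurableSet_Icc
  have h3 : MeasurableSet {p : U | u1 p.1 ∈ Ico (0 : ℝ) 1} :=
    (measurable_u1.comp measurable_subtype_coe) measurableSet_Ico
  have h4 : MeasurableSet {p : U | p.1 2 ∈ Ico (0 : ℝ) 1} :=
    ((measurable_pi_apply 2).comp measurable_subtype_coe) measurableSet_Ico
  have : DInf = {p : U | rho p ∈ 𝒟} ∩ {p | u2 p.1 ∈ Icc (0 : ℝ) (1 / 2)} ∩
      {p | u1 p.1 ∈ Ico (0 : ℝ) 1} ∩ {p : U | p.1 2 ∈ Ico (0 : ℝ) 1} := by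
    ext p; simp [DInf, and_assoc]
  rw [this]
  exact ((h1.inter h2).inter h3).inter h4

/-- **`𝓓∞` is an exact fundamental domain for `Γ∞ = Stab(e)`** acting on `H₂`. [folklore] -/
theorem isSiegelFD_DInf : IsSiegelFD GammaInf DInf where
  measurableSet := measurableSet_DInf
  covers := DInf_covers
  ae_unique := by
    rw [ae_iff]
    refine measure_mono_null ?_ siegelVolume_badSet
    intro p hp
    simp only [mem_setOf_eq, not_forall, exists_prop] at hp
    obtain ⟨hpD, γ, hγ, hγp, hne⟩ := hp
    by_contra hbad
    simp only [badSet, mem_union, mem_setOf_eq, not_or, not_and] at hbad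
    obtain ⟨⟨h1, h2⟩, h3⟩ := hbad
    have hρo : rho p ∈ 𝒟ᵒ := by
      by_contra h; exact h1 h hpD.1
    exact hne (Or.inl (DInf_unique hpD hρo h2 h3 hγ hγp))

end DInfFD

/-! ### The cusp coordinates `Φ` and their Jacobian -/

section CuspCoords

open MeasureTheory Set
open scoped ENNReal

/-- The cusp coordinates `w = (ρ₁, ρ₂, u₂, u₁, t₁, t) ↦ x = (ρ₁, ρ₁u₂ - u₁, t₁, ρ₂, ρ₂u₂, t + ρ₂u₂²)`
(Pioline (3.5): `Ω = (ρ, ρu₂ - u₁; ρu₂ - u₁, t₁ + i(t + ρ₂u₂²))`). [folklore] -/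
def Phi (w : Fin 6 → ℝ) : Fin 6 → ℝ :=
  ![w 0, w 0 * w 2 - w 3, w 4, w 1, w 1 * w 2, w 5 + w 1 * w 2 ^ 2]

/-- The inverse coordinates `x ↦ (x₀, x₃, x₄/x₃, x₀x₄/x₃ - x₁, x₂, (x₃x₅ - x₄²)/x₃)`. [folklore] -/
def Psi (x : Fin 6 → ℝ) : Fin 6 → ℝ :=
  ![x 0, x 3, x 4 / x 3, x 0 * x 4 / x 3 - x 1, x 2, (x 3 * x 5 - x 4 ^ 2) / x 3]

/-- `Φ ∘ Ψ = id` on `x₃ ≠ 0`. [folklore] -/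
theorem Phi_Psi {x : Fin 6 → ℝ} (hx : x 3 ≠ 0) : Phi (Psi x) = x := by
  ext i
  fin_cases i <;> simp [Phi, Psi] <;> field_simp <;> ring

/-- `Ψ ∘ Φ = id` on `ρ₂ ≠ 0`. [folklore] -/
theorem Psi_Phi {w : Fin 6 → ℝ} (hw : w 1 ≠ 0) : Psi (Phi w) = w := by
  ext i
  fin_cases i <;> simp [Phi, Psi] <;> field_simp <;> ring

/-- The Jacobian matrix of `Φ`. [folklore] -/
def jacPhi (w : Fin 6 → ℝ) : Matrix (Fin 6) (Fin 6) ℝ :=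
  !![1, 0, 0, 0, 0, 0;
     w 2, 0, w 0, -1, 0, 0;
     0, 0, 0, 0, 1, 0;
     0, 1, 0, 0, 0, 0;
     0, w 2, w 1, 0, 0, 0;
     0, w 2 ^ 2, 2 * w 1 * w 2, 0, 0, 1]

/-- The row permutation making the Jacobian lower triangular. [folklore] -/
def rowPerm : Equiv.Perm (Fin 6) := Equiv.swap 1 3 * Equiv.swap 2 4

/-- `det jacPhi w = -w₁`. [folklore] -/
theorem det_jacPhi (w : Fin 6 → ℝ) : (jacPhi w).det = -w 1 := by
  have hperm := Matrix.det_permute rowPerm (jacPhi w)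
  have hsign : Equiv.Perm.sign rowPerm = 1 := by
    rw [rowPerm, Equiv.Perm.sign_mul, Equiv.Perm.sign_swap (by decide), Equiv.Perm.sign_swap (by decide)]
    rfl
  have htri : ((jacPhi w).submatrix rowPerm id).BlockTriangular OrderDual.toDual := by
    intro i j hij
    have hij' : i < j := OrderDual.toDual_lt_toDual.1 hij
    fin_cases i <;> fin_cases j <;> simp at hij' <;>
      simp [Matrix.submatrix_apply, jacPhi, rowPerm, Equiv.swap_apply_def]
  have hdet' := Matrix.det_of_lowerTriangular _ htri
  have hdiag : ∏ i : Fin 6, ((jacPhi w).submatrix rowPerm id) i i = -w 1 := by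
    rw [Fin.prod_univ_six]
    simp [Matrix.submatrix_apply, jacPhi, rowPerm, Equiv.swap_apply_def]
  rw [hsign, Units.val_one, Int.cast_one, one_mul] at hperm
  rw [← hperm, hdet', hdiag]

/-- The derivative of `Φ` as a continuous linear map. [folklore] -/
def PhiDeriv (w : Fin 6 → ℝ) : (Fin 6 → ℝ) →L[ℝ] (Fin 6 → ℝ) :=
  LinearMap.toContinuousLinearMap (Matrix.toLin' (jacPhi w))

/-- `PhiDeriv` is multiplication by the Jacobian matrix. [folklore] -/
theorem PhiDeriv_apply (w v : Fin 6 → ℝ) : PhiDeriv w v = jacPhi w *ᵥ v := rfl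

/-- `det DΦ = -ρ₂`. [folklore] -/
theorem det_PhiDeriv (w : Fin 6 → ℝ) : (PhiDeriv w).det = -w 1 := by
  rw [ContinuousLinearMap.det, PhiDeriv, LinearMap.coe_toContinuousLinearMap, LinearMap.det_toLin',
    det_jacPhi]

/-- `Φ` is differentiable with derivative `PhiDeriv`. [folklore] -/
theorem hasFDerivAt_Phi (w : Fin 6 → ℝ) : HasFDerivAt Phi (PhiDeriv w) w := by
  apply hasFDerivAt_pi''
  intro i
  have h0 := hasFDerivAt_apply (𝕜 := ℝ) 0 w
  have h1 := hasFDerivAt_apply (𝕜 := ℝ) 1 w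
  have h2 := hasFDerivAt_apply (𝕜 := ℝ) 2 w
  have h3 := hasFDerivAt_apply (𝕜 := ℝ) 3 w
  have h4 := hasFDerivAt_apply (𝕜 := ℝ) 4 w
  have h5 := hasFDerivAt_apply (𝕜 := ℝ) 5 w
  fin_cases i
  · refine h0.congr_fderiv ?_
    ext v; simp [PhiDeriv_apply, jacPhi, dotProduct, Fin.sum_univ_succ]
  · refine ((h0.mul h2).sub h3).congr_fderiv ?_
    ext v
    simp [PhiDeriv_apply, jacPhi, dotProduct, Fin.sum_univ_succ]
    ring
  · refine h4.congr_fderiv ?_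
    ext v; simp [PhiDeriv_apply, jacPhi, dotProduct, Fin.sum_univ_succ]
  · refine h1.congr_fderiv ?_
    ext v; simp [PhiDeriv_apply, jacPhi, dotProduct, Fin.sum_univ_succ]
  · refine (h1.mul h2).congr_fderiv ?_
    ext v
    simp [PhiDeriv_apply, jacPhi, dotProduct, Fin.sum_univ_succ]
    ring
  · refine (h5.add (h1.mul (h2.pow 2))).congr_fderiv ?_
    ext v
    simp [PhiDeriv_apply, jacPhi, dotProduct, Fin.sum_univ_succ]
    ring

end CuspCoords

/-! ### Integration over `𝓓∞` -/

section CuspIntegral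

open MeasureTheory Set
open scoped ENNReal MatrixGroups UpperHalfPlane Modular

/-- Integration against the symplectic volume over a measurable set, as a Lebesgue integral over
its image in `ℝ⁶`. [folklore] -/
theorem setLIntegral_siegelVolume {S : Set U} (hS : MeasurableSet S) {G : (Fin 6 → ℝ) → ℝ≥0∞}
    (hG : Measurable G) :
    ∫⁻ p in S, G p.1 ∂siegelVolume =
      ∫⁻ x in Subtype.val '' S, G x * ENNReal.ofReal (density x) ∂volume := by
  have hmp : MeasurePreserving ((↑) : U → Fin 6 → ℝ) (volume.comap ((↑) : U → Fin 6 → ℝ))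
      (volume.restrict (range ((↑) : U → Fin 6 → ℝ))) :=
    ⟨measurable_subtype_coe, by rw [measurableEmbedding_val.map_comap]⟩
  have hf : Measurable fun p : U => ENNReal.ofReal (density p.1) :=
    (measurable_density.comp measurable_subtype_coe).ennreal_ofReal
  have hg : Measurable fun p : U => G p.1 := hG.comp measurable_subtype_coe
  rw [siegelVolume, setLIntegral_withDensity_eq_setLIntegral_mul
    (f := fun p : U => ENNReal.ofReal (density p.1)) (g := fun p : U => G p.1) _ hf hg hS]
  have h := hmp.setLIntegral_comp_emb measurableEmbedding_val
    (fun x => G x * ENNReal.ofReal (density x)) S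
  rw [Measure.restrict_restrict' measurableEmbedding_val.measurableSet_range,
    Set.inter_eq_self_of_subset_left (Set.image_subset_range _ _)] at h
  rw [← h]
  apply lintegral_congr
  intro p
  simp only [Pi.mul_apply]
  rw [mul_comm]

/-- **Splitting a Lebesgue integral over `ι → ℝ` along a partition of the coordinates**:
for a product set and a product integrand. [folklore] -/
theorem setLIntegral_pi_split {ι : Type*} [Fintype ι] (pr : ι → Prop) [DecidablePred pr]
    (S₁ : Set ({i // pr i} → ℝ)) (S₂ : Set ({i // ¬pr i} → ℝ))
    {f₁ : ({i // pr i} → ℝ) → ℝ≥0∞} {f₂ : ({i // ¬pr i} → ℝ) → ℝ≥0∞}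
    (hf₁ : Measurable f₁) (hf₂ : Measurable f₂) :
    ∫⁻ w in {w : ι → ℝ | (fun i : {i // pr i} => w i) ∈ S₁ ∧ (fun i : {i // ¬pr i} => w i) ∈ S₂},
        f₁ (fun i => w i) * f₂ (fun i => w i) ∂volume =
      (∫⁻ y in S₁, f₁ y ∂volume) * (∫⁻ z in S₂, f₂ z ∂volume) := by
  set e' := MeasurableEquiv.piEquivPiSubtypeProd (fun _ : ι => ℝ) pr with he'
  have e := volume_preserving_piEquivPiSubtypeProd (fun _ : ι => ℝ) pr
  have hset : {w : ι → ℝ | (fun i : {i // pr i} => w i) ∈ S₁ ∧ (fun i : {i // ¬pr i} => w i) ∈ S₂} =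
      e' ⁻¹' (S₁ ×ˢ S₂) := by
    ext w; simp [he', MeasurableEquiv.piEquivPiSubtypeProd, Equiv.piEquivPiSubtypeProd]
  have h := e.setLIntegral_comp_preimage_emb e'.measurableEmbedding
    (fun q => f₁ q.1 * f₂ q.2) (S₁ ×ˢ S₂)
  rw [hset]
  have hint : (fun w : ι → ℝ => f₁ (fun i => w i) * f₂ (fun i => w i)) =
      fun w => (fun q : ({i // pr i} → ℝ) × ({i // ¬pr i} → ℝ) => f₁ q.1 * f₂ q.2) (e' w) := by
    funext w; rfl
  rw [hint, h, Measure.volume_eq_prod, ← Measure.prod_restrict,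
    lintegral_prod_mul hf₁.aemeasurable hf₂.aemeasurable]

/-! #### The coordinate partition `{2,3,4} ⊔ ({0,1} ⊔ {5})` -/

/-- The box coordinates `u₂, u₁, t₁` (indices `2, 3, 4` of `w`). [folklore] -/
def prBox (i : Fin 6) : Prop := i = 2 ∨ i = 3 ∨ i = 4

/-- Decidability of `prBox`. [folklore] -/
instance instDecidablePredPrBox : DecidablePred prBox := fun i => by unfold prBox; infer_instance

/-- Among the remaining coordinates `{0, 1, 5}`, the `ρ`-coordinates `{0, 1}`. [folklore] -/
def prRho (j : {i : Fin 6 // ¬prBox i}) : Prop := j.1 = 0 ∨ j.1 = 1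

/-- Decidability of `prRho`. [folklore] -/
instance instDecidablePredPrRho : DecidablePred prRho := fun j => by unfold prRho; infer_instance

/-- `0 ∉ {2,3,4}`. [folklore] -/
theorem not_prBox_0 : ¬prBox 0 := by decide
/-- `1 ∉ {2,3,4}`. [folklore] -/
theorem not_prBox_1 : ¬prBox 1 := by decide
/-- `5 ∉ {2,3,4}`. [folklore] -/
theorem not_prBox_5 : ¬prBox 5 := by decide

/-- `Fin 2 ≃` the `ρ`-indices. [folklore] -/
def idxRho : Fin 2 ≃ {j : {i : Fin 6 // ¬prBox i} // prRho j} where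
  toFun k := if k = 0 then ⟨⟨0, not_prBox_0⟩, Or.inl rfl⟩ else ⟨⟨1, not_prBox_1⟩, Or.inr rfl⟩
  invFun j := if j.1.1 = 0 then 0 else 1
  left_inv k := by
    fin_cases k
    · simp
    · simp only; rw [if_neg (by decide)]; simp
  right_inv j := by
    obtain ⟨⟨j, hj⟩, hj'⟩ := j
    apply Subtype.ext; apply Subtype.ext
    rcases hj' with h | h <;> simp only at h <;> subst h
    · simp
    · simp

/-- The `t`-index `5` is the unique remaining one. [folklore] -/
instance uniqueIdxT : Unique {j : {i : Fin 6 // ¬prBox i} // ¬prRho j} where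
  default := ⟨⟨5, not_prBox_5⟩, by decide⟩
  uniq j := by
    obtain ⟨⟨j, hj⟩, hj'⟩ := j
    simp only [prBox, prRho, not_or] at hj hj'
    apply Subtype.ext; apply Subtype.ext
    simp only
    fin_cases j <;> simp_all

/-- The box `[0, 1/2] × [0, 1) × [0, 1)` in the coordinates `(u₂, u₁, t₁)`. [folklore] -/
def boxSet : Set ({i : Fin 6 // prBox i} → ℝ) :=
  {y | y ⟨2, Or.inl rfl⟩ ∈ Icc (0 : ℝ) (1 / 2) ∧ y ⟨3, Or.inr (Or.inl rfl)⟩ ∈ Ico (0 : ℝ) 1 ∧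
    y ⟨4, Or.inr (Or.inr rfl)⟩ ∈ Ico (0 : ℝ) 1}

/-- The box has volume `1/2`. [folklore] -/
theorem volume_boxSet : volume boxSet = ENNReal.ofReal (1 / 2) := by
  classical
  set B : {i : Fin 6 // prBox i} → Set ℝ := fun i => if i.1 = 2 then Icc 0 (1 / 2) else Ico 0 1
    with hB
  have hbox : boxSet = Set.pi univ B := by
    ext y
    simp only [boxSet, mem_setOf_eq, mem_univ_pi, hB]
    constructor
    · rintro ⟨h2, h3, h4⟩ ⟨i, hi⟩
      rcases hi with hi | hi | hi <;> subst hi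
      · simpa using h2
      · rw [if_neg (by decide)]; exact h3
      · rw [if_neg (by decide)]; exact h4
    · intro h
      refine ⟨?_, ?_, ?_⟩
      · simpa using h ⟨2, Or.inl rfl⟩
      · have := h ⟨3, Or.inr (Or.inl rfl)⟩; rw [if_neg (by decide)] at this; exact this
      · have := h ⟨4, Or.inr (Or.inr rfl)⟩; rw [if_neg (by decide)] at this; exact this
  rw [hbox, volume_pi_pi]
  rw [Finset.prod_eq_single_of_mem (⟨2, Or.inl rfl⟩ : {i : Fin 6 // prBox i}) (Finset.mem_univ _)]
  · simp [hB]
  · rintro ⟨b, hb⟩ - hne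
    have hb2 : b ≠ 2 := fun h => hne (Subtype.ext h)
    rw [hB]; simp only
    rw [if_neg hb2, Real.volume_Ico]
    simp

/-- The `ρ`-domain `{ρ₂ > 0, |ρ|² ≥ 1, |ρ₁| ≤ 1/2}` in the `ρ`-coordinates. [folklore] -/
def rhoSet : Set ({j : {i : Fin 6 // ¬prBox i} // prRho j} → ℝ) :=
  {v | 0 < v (idxRho 1) ∧ 1 ≤ v (idxRho 0) ^ 2 + v (idxRho 1) ^ 2 ∧ |v (idxRho 0)| ≤ 1 / 2}

/-- **`∫_{𝒟} dρ₁ dρ₂ / ρ₂² = π/3`** in the `ρ`-coordinates (from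
`Literature.NumberTheory.Automorphic.volume_modular_fd`). [folklore] -/
theorem lintegral_rhoSet :
    ∫⁻ v in rhoSet, ENNReal.ofReal ((v (idxRho 1))⁻¹ ^ 2) = ENNReal.ofReal (Real.pi / 3) := by
  -- Step 1: the known value in `ℝ × ℝ`
  set T : Set (ℝ × ℝ) := {q | 0 < q.2 ∧ 1 ≤ q.1 * q.1 + q.2 * q.2 ∧ |q.1| ≤ 1 / 2} with hT
  have hTm : MeasurableSet T := by
    simp only [hT, Set.setOf_and]
    refine (measurableSet_lt measurable_const measurable_snd).inter
      ((measurableSet_le measurable_const (by fun_prop)).inter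
        (measurableSet_le (by fun_prop) measurable_const))
  have hval : ∫⁻ q in T, (((1 / ‖q.2‖₊) ^ 2 : NNReal) : ℝ≥0∞) = ENNReal.ofReal (Real.pi / 3) := by
    rw [← Literature.NumberTheory.Automorphic.volume_modular_fd, UpperHalfPlane.volume_eq_lintegral]
    have hS : ((↑) '' 𝒟 : Set ℂ) =
        {z : ℂ | 0 < z.im ∧ 1 ≤ z.re * z.re + z.im * z.im ∧ |z.re| ≤ 1 / 2} := by
      ext z
      constructor
      · rintro ⟨w, hw, rfl⟩
        exact ⟨w.im_pos, by simpa [Complex.normSq_apply] using hw.1, hw.2⟩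
      · rintro ⟨h0, h1, h2⟩
        exact ⟨⟨z, h0⟩, ⟨by simpa [Complex.normSq_apply] using h1, h2⟩, rfl⟩
    rw [hS]
    have hmp := Complex.volume_preserving_equiv_real_prod.symm
    rw [← hmp.setLIntegral_comp_preimage_emb Complex.measurableEquivRealProd.symm.measurableEmbedding]
    have hpre : Complex.measurableEquivRealProd.symm ⁻¹'
        {z : ℂ | 0 < z.im ∧ 1 ≤ z.re * z.re + z.im * z.im ∧ |z.re| ≤ 1 / 2} = T := by
      ext p; simp [Complex.measurableEquivRealProd_symm_apply, hT]
    rw [hpre]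
    apply lintegral_congr
    intro q
    simp [Complex.measurableEquivRealProd_symm_apply]
  -- Step 2: replace the `NNReal` density by `ofReal (y⁻¹ ^ 2)` on `T`
  have hval' : ∫⁻ q in T, ENNReal.ofReal ((q.2)⁻¹ ^ 2) = ENNReal.ofReal (Real.pi / 3) := by
    rw [← hval]
    apply setLIntegral_congr_fun hTm
    intro q hq
    beta_reduce
    rw [Literature.NumberTheory.Automorphic.ennreal_inv_nnnorm_sq hq.1, Real.rpow_neg hq.1.le,
      Real.rpow_two, inv_pow]
  -- Step 3: transport to the `ρ`-coordinates
  set E : ({j : {i : Fin 6 // ¬prBox i} // prRho j} → ℝ) ≃ᵐ ℝ × ℝ :=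
    (MeasurableEquiv.piCongrLeft (fun _ => ℝ) idxRho).symm.trans MeasurableEquiv.finTwoArrow with hE
  have hEmp : MeasurePreserving E volume volume :=
    (volume_preserving_finTwoArrow ℝ).comp
      (volume_measurePreserving_piCongrLeft (fun _ => ℝ) idxRho).symm
  have hE0 : ∀ v, (E v).1 = v (idxRho 0) := fun v => by
    simp [hE, MeasurableEquiv.finTwoArrow, MeasurableEquiv.piCongrLeft, Equiv.piCongrLeft]
  have hE1 : ∀ v, (E v).2 = v (idxRho 1) := fun v => by
    simp [hE, MeasurableEquiv.finTwoArrow, MeasurableEquiv.piCongrLeft, Equiv.piCongrLeft]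
  have hset : rhoSet = E ⁻¹' T := by
    ext v
    simp only [rhoSet, mem_setOf_eq, mem_preimage, hT, hE0, hE1, sq]
  rw [hset, ← hval']
  rw [← hEmp.setLIntegral_comp_preimage_emb E.measurableEmbedding]
  apply lintegral_congr
  intro v
  rw [hE1]

/-- **`∫` over the `t`-coordinate**: `∫_{t > 0} G(t)` in the coordinates. [folklore] -/
theorem lintegral_tSet (G : ℝ → ℝ≥0∞) :
    ∫⁻ u in {u : {j : {i : Fin 6 // ¬prBox i} // ¬prRho j} → ℝ | 0 < u default}, G (u default) =
      ∫⁻ t in Ioi 0, G t := by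
  have hmp := volume_preserving_funUnique {j : {i : Fin 6 // ¬prBox i} // ¬prRho j} ℝ
  have hset : {u : {j : {i : Fin 6 // ¬prBox i} // ¬prRho j} → ℝ | 0 < u default} =
      (MeasurableEquiv.funUnique {j : {i : Fin 6 // ¬prBox i} // ¬prRho j} ℝ) ⁻¹' Ioi 0 := by
    ext u; simp [MeasurableEquiv.funUnique]
  rw [hset, ← hmp.setLIntegral_comp_preimage_emb (MeasurableEquiv.measurableEmbedding _)]
  rfl

/-! #### The main computation -/

/-- `t(x) = (x₃x₅ - x₄²)/x₃` (`= det Y / y₁₁ = 1 / P_Z[e]`). [folklore] -/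
def tOf (x : Fin 6 → ℝ) : ℝ := (x 3 * x 5 - x 4 ^ 2) / x 3

/-- `t` is measurable. [folklore] -/
theorem measurable_tOf : Measurable tOf := by unfold tOf; fun_prop

/-- The parameter domain `Ω` of the cusp coordinates. [folklore] -/
def Omega : Set (Fin 6 → ℝ) :=
  {w | 0 < w 1 ∧ 1 ≤ w 0 ^ 2 + w 1 ^ 2 ∧ |w 0| ≤ 1 / 2 ∧ w 2 ∈ Icc (0 : ℝ) (1 / 2) ∧
    w 3 ∈ Ico (0 : ℝ) 1 ∧ w 4 ∈ Ico (0 : ℝ) 1 ∧ 0 < w 5}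

/-- `Ω` is measurable. [folklore] -/
theorem measurableSet_Omega : MeasurableSet Omega := by
  have e : Omega = {w : Fin 6 → ℝ | 0 < w 1} ∩ {w | 1 ≤ w 0 ^ 2 + w 1 ^ 2} ∩ {w | |w 0| ≤ 1 / 2} ∩
      {w | w 2 ∈ Icc (0 : ℝ) (1 / 2)} ∩ {w | w 3 ∈ Ico (0 : ℝ) 1} ∩ {w | w 4 ∈ Ico (0 : ℝ) 1} ∩
      {w | 0 < w 5} := by
    ext w; simp [Omega, and_assoc]
  rw [e]
  refine ((((((measurableSet_lt measurable_const (measurable_pi_apply 1)).inter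
    (measurableSet_le measurable_const (by fun_prop))).inter
    (measurableSet_le (by fun_prop) measurable_const)).inter
    ((measurable_pi_apply 2) measurableSet_Icc)).inter
    ((measurable_pi_apply 3) measurableSet_Ico)).inter
    ((measurable_pi_apply 4) measurableSet_Ico)).inter
    (measurableSet_lt measurable_const (measurable_pi_apply 5))

/-- `Φ` is injective on `Ω`. [folklore] -/
theorem injOn_Phi : InjOn Phi Omega := by
  intro w hw w' hw' h
  have h1 := congrArg Psi h
  rwa [Psi_Phi hw.1.ne', Psi_Phi hw'.1.ne'] at h1

/-- `Φ(Ω) ⊆ H₂`. [folklore] -/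
theorem Phi_mem_U {w : Fin 6 → ℝ} (hw : w ∈ Omega) : Phi w ∈ U := by
  obtain ⟨h1, -, -, -, -, -, h5⟩ := hw
  refine ⟨by simpa [Phi] using h1, ?_⟩
  have : Phi w 3 * Phi w 5 - Phi w 4 ^ 2 = w 1 * w 5 := by simp [Phi]; ring
  nlinarith [mul_pos h1 h5]

/-- **`𝓓∞` in the cusp coordinates**: `val '' 𝓓∞ = Φ(Ω)`. [folklore] -/
theorem image_DInf : Subtype.val '' DInf = Phi '' Omega := by
  ext x
  constructor
  · rintro ⟨p, hp, rfl⟩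
    obtain ⟨hρ, hu2, hu1, hx2⟩ := hp
    have h3 : 0 < p.1 3 := p.2.1
    have hD : 0 < p.1 3 * p.1 5 - p.1 4 ^ 2 := by nlinarith [p.2.2]
    refine ⟨Psi p.1, ?_, Phi_Psi h3.ne'⟩
    have hc : ((rho p : ℍ) : ℂ) = (p.1 0 : ℂ) + p.1 3 * Complex.I := coe_rho p
    have hns : Complex.normSq ((rho p : ℍ) : ℂ) = p.1 0 ^ 2 + p.1 3 ^ 2 := by
      rw [hc, Complex.normSq_apply]; simp; ring
    have hre : (rho p).re = p.1 0 := by rw [← UpperHalfPlane.coe_re, hc]; simp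
    simp only [ModularGroup.fd, mem_setOf_eq, hns, hre] at hρ
    refine ⟨by simpa [Psi] using h3, by simpa [Psi] using hρ.1, by simpa [Psi] using hρ.2,
      by simpa [Psi, u2] using hu2, ?_, by simpa [Psi] using hx2, ?_⟩
    · simpa [Psi, u1, mul_div_assoc] using hu1
    · simp only [Psi, Matrix.cons_val]
      exact div_pos hD h3
  · rintro ⟨w, hw, rfl⟩
    have hU := Phi_mem_U hw
    obtain ⟨h1, hn, hre, h2, h3, h4, h5⟩ := hw
    refine ⟨⟨Phi w, hU⟩, ?_, rfl⟩
    have hc : ((rho ⟨Phi w, hU⟩ : ℍ) : ℂ) = (w 0 : ℂ) + w 1 * Complex.I := by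
      rw [coe_rho]; simp [Phi]
    have hns : Complex.normSq ((rho ⟨Phi w, hU⟩ : ℍ) : ℂ) = w 0 ^ 2 + w 1 ^ 2 := by
      rw [hc, Complex.normSq_apply]; simp; ring
    have hre' : (rho ⟨Phi w, hU⟩).re = w 0 := by rw [← UpperHalfPlane.coe_re, hc]; simp
    refine ⟨?_, ?_, ?_, ?_⟩
    · simp only [ModularGroup.fd, mem_setOf_eq, hns, hre']
      exact ⟨hn, hre⟩
    · have : u2 (Phi w) = w 2 := by
        simp only [u2, Phi, Matrix.cons_val]; field_simp
      simp only [this]; exact h2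
    · have : u1 (Phi w) = w 3 := by
        simp only [u1, Phi, Matrix.cons_val]; field_simp; ring
      simp only [this]; exact h3
    · simpa [Phi] using h4

/-- The remaining coordinates `{0, 1, 5}`: the `ρ`-domain times `t > 0`. [folklore] -/
def restSet : Set ({i : Fin 6 // ¬prBox i} → ℝ) :=
  {z | 0 < z ⟨1, not_prBox_1⟩ ∧ 1 ≤ z ⟨0, not_prBox_0⟩ ^ 2 + z ⟨1, not_prBox_1⟩ ^ 2 ∧
    |z ⟨0, not_prBox_0⟩| ≤ 1 / 2 ∧ 0 < z ⟨5, not_prBox_5⟩}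

/-- `idxRho 0` is the index `0`. [folklore] -/
theorem idxRho_zero : ((idxRho 0 : {j : {i : Fin 6 // ¬prBox i} // prRho j}) : {i : Fin 6 // ¬prBox i}) =
    ⟨0, not_prBox_0⟩ := by simp [idxRho]

/-- `idxRho 1` is the index `1`. [folklore] -/
theorem idxRho_one : ((idxRho 1 : {j : {i : Fin 6 // ¬prBox i} // prRho j}) : {i : Fin 6 // ¬prBox i}) =
    ⟨1, not_prBox_1⟩ := by
  simp only [idxRho, Equiv.coe_fn_mk]; rw [if_neg (by decide)]

/-- The `t`-index is `5`. [folklore] -/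
theorem default_idxT : ((default : {j : {i : Fin 6 // ¬prBox i} // ¬prRho j}) : {i : Fin 6 // ¬prBox i}) =
    ⟨5, not_prBox_5⟩ := rfl

/-- **The cusp integral**: for measurable `F ≥ 0`,
`∫_{𝓓∞} F(t(p)) dv(p) = (π/3) · (1/2) · ∫_0^∞ F(t) t⁻³ dt`
(`dv = dρ₁dρ₂/ρ₂² · du₁ du₂ dt₁ · t⁻³ dt` in the cusp coordinates; Pioline (3.7)). [folklore] -/
theorem setLIntegral_DInf (F : ℝ → ℝ≥0∞) (hF : Measurable F) :
    ∫⁻ p in DInf, F (tOf p.1) ∂siegelVolume =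
      ENNReal.ofReal (Real.pi / 3) * ENNReal.ofReal (1 / 2) *
        ∫⁻ t in Ioi 0, F t * ENNReal.ofReal (t⁻¹ ^ 3) := by
  rw [setLIntegral_siegelVolume measurableSet_DInf (G := fun x => F (tOf x)) (hF.comp measurable_tOf),
    image_DInf, lintegral_image_eq_lintegral_abs_det_fderiv_mul volume measurableSet_Omega
      (fun w _ => (hasFDerivAt_Phi w).hasFDerivWithinAt) injOn_Phi]
  -- the integrand in the cusp coordinates
  set f₂ : ({i : Fin 6 // ¬prBox i} → ℝ) → ℝ≥0∞ := fun z =>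
    ENNReal.ofReal ((z ⟨1, not_prBox_1⟩)⁻¹ ^ 2) *
      (F (z ⟨5, not_prBox_5⟩) * ENNReal.ofReal ((z ⟨5, not_prBox_5⟩)⁻¹ ^ 3)) with hf₂
  have hf₂m : Measurable f₂ := by
    rw [hf₂]
    exact ((measurable_pi_apply _).inv.pow_const 2).ennreal_ofReal.mul
      ((hF.comp (measurable_pi_apply _)).mul ((measurable_pi_apply _).inv.pow_const 3).ennreal_ofReal)
  have hpt : ∀ w ∈ Omega, ENNReal.ofReal |(PhiDeriv w).det| *
      (F (tOf (Phi w)) * ENNReal.ofReal (density (Phi w))) =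
      (fun _ : {i : Fin 6 // prBox i} → ℝ => (1 : ℝ≥0∞)) (fun i => w i) * f₂ (fun i => w i) := by
    intro w hw
    have h1 : 0 < w 1 := hw.1
    have h5 : 0 < w 5 := hw.2.2.2.2.2.2
    have hdet : |(PhiDeriv w).det| = w 1 := by rw [det_PhiDeriv, abs_neg, abs_of_pos h1]
    have hq : Phi w 3 * Phi w 5 - Phi w 4 ^ 2 = w 1 * w 5 := by simp [Phi]; ring
    have ht : tOf (Phi w) = w 5 := by
      unfold tOf; rw [hq]; simp [Phi]; field_simp
    have hd : density (Phi w) = ((w 1 * w 5)⁻¹) ^ 3 := by unfold density; rw [hq]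
    rw [hdet, ht, hd, hf₂]
    show ENNReal.ofReal (w 1) * (F (w 5) * ENNReal.ofReal ((w 1 * w 5)⁻¹ ^ 3)) =
      1 * (ENNReal.ofReal ((w 1)⁻¹ ^ 2) * (F (w 5) * ENNReal.ofReal ((w 5)⁻¹ ^ 3)))
    have key : ENNReal.ofReal (w 1) * ENNReal.ofReal ((w 1 * w 5)⁻¹ ^ 3) =
        ENNReal.ofReal ((w 1)⁻¹ ^ 2) * ENNReal.ofReal ((w 5)⁻¹ ^ 3) := by
      rw [← ENNReal.ofReal_mul h1.le, ← ENNReal.ofReal_mul (by positivity)]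
      congr 1
      field_simp
    calc ENNReal.ofReal (w 1) * (F (w 5) * ENNReal.ofReal ((w 1 * w 5)⁻¹ ^ 3))
        = F (w 5) * (ENNReal.ofReal (w 1) * ENNReal.ofReal ((w 1 * w 5)⁻¹ ^ 3)) := by ring
      _ = F (w 5) * (ENNReal.ofReal ((w 1)⁻¹ ^ 2) * ENNReal.ofReal ((w 5)⁻¹ ^ 3)) := by rw [key]
      _ = 1 * (ENNReal.ofReal ((w 1)⁻¹ ^ 2) * (F (w 5) * ENNReal.ofReal ((w 5)⁻¹ ^ 3))) := by ring
  rw [setLIntegral_congr_fun measurableSet_Omega hpt]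
  have hΩ : Omega = {w : Fin 6 → ℝ | (fun i : {i // prBox i} => w i) ∈ boxSet ∧
      (fun i : {i // ¬prBox i} => w i) ∈ restSet} := by
    ext w
    simp only [Omega, boxSet, restSet, mem_setOf_eq]
    tauto
  rw [hΩ, setLIntegral_pi_split prBox boxSet restSet measurable_const hf₂m, setLIntegral_one,
    volume_boxSet]
  -- second split: `{0,1,5} = {0,1} ⊔ {5}`
  set g₁ : ({j : {i : Fin 6 // ¬prBox i} // prRho j} → ℝ) → ℝ≥0∞ := fun v =>
    ENNReal.ofReal ((v (idxRho 1))⁻¹ ^ 2) with hg₁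
  set g₂ : ({j : {i : Fin 6 // ¬prBox i} // ¬prRho j} → ℝ) → ℝ≥0∞ := fun u =>
    F (u default) * ENNReal.ofReal ((u default)⁻¹ ^ 3) with hg₂
  have hg₁m : Measurable g₁ := ((measurable_pi_apply _).inv.pow_const 2).ennreal_ofReal
  have hg₂m : Measurable g₂ :=
    (hF.comp (measurable_pi_apply _)).mul ((measurable_pi_apply _).inv.pow_const 3).ennreal_ofReal
  have hrest : restSet = {z : {i : Fin 6 // ¬prBox i} → ℝ |
      (fun j : {j // prRho j} => z j) ∈ rhoSet ∧
      (fun j : {j // ¬prRho j} => z j) ∈ {u | 0 < u default}} := by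
    ext z
    simp only [restSet, rhoSet, mem_setOf_eq, idxRho_zero, idxRho_one, default_idxT]
    tauto
  have hf₂eq : ∀ z : {i : Fin 6 // ¬prBox i} → ℝ,
      f₂ z = g₁ (fun j => z j) * g₂ (fun j => z j) := by
    intro z
    simp only [hf₂, hg₁, hg₂, idxRho_one, default_idxT]
  simp_rw [hf₂eq]
  rw [hrest, setLIntegral_pi_split prRho rhoSet {u | 0 < u default} hg₁m hg₂m, hg₁, lintegral_rhoSet,
    hg₂, lintegral_tSet (fun t => F t * ENNReal.ofReal (t⁻¹ ^ 3))]
  ring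

end CuspIntegral

end Literature.NumberTheory.ModularForms.Sp4Covolume
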